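import Literature.AlgebraicGeometry.Motives.CartierDivisorGysinProjective
import Literature.AlgebraicGeometry.Motives.CompleteIntersectionInclusion
import Literature.AlgebraicGeometry.Motives.HirschowitzIyerQuadricCubic
import Literature.AlgebraicGeometry.Motives.JacobianQuadricCubic
import HarnessLib

/-!
# The Gysin map `CH₂(V₊(Q)) → CH₁(V₊(Q, C))` and the reduction of Hirschowitz–Iyer's theorem to
# the `ℚ`-surjectivity of that map

For a quadric `Q` and a cubic `C` on `ℙⁿ_K` with `Y' = V₊(Q)` integral and `C` not vanishing
identically on `Y'`, the cubic section `D = V₊(C)|_{Y'}` is an effective Cartier divisor on `Y'` with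
support `Y = V₊(Q, C)` (`ProjSpace.avoids_pullbackAvoiding_formDivisor_iff`), and Fulton's
"intersecting with `D`" (`CartierDivisor.IsEffective.gysin`, `Motives/CartierDivisorGysin`, with its
two hypotheses supplied by `ProjSpace.gysin_hypotheses`, `Motives/CartierDivisorGysinProjective`) is
the restriction homomorphism

* `quadricCubicGysin : CH_{d+1}(V₊(Q)) → CH_d(V₊(Q, C))`

of Hirschowitz–Iyer, Contemp. Math. 522 (2010), §2 ("the restriction map
`QCH_{r+1}(Y') → QCH_r(Y)`"). The second part is the algebra of HI's Main Theorem (§1.6: "if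
`QCH_{r+1}(Y')` is trivial, then so is `QCH_r(Y)`", through the surjectivity theorem of §1.4/§2):

* `rankLEOne_of_forall_exists_zsmul_eq` — if a homomorphism `f : A → B` is surjective after
  `⊗ ℚ` (`∀ b, ∃ N ≠ 0, N • b ∈ f(A)`) and `A` has `ℚ`-rank `≤ 1` (any two elements are
  `ℤ`-dependent), then so has `B`;
* `HirschowitzIyer2010_QCH1_quadricCubic_P8_of_forall_exists` — the named fact
  `HirschowitzIyer2010_QCH1_quadricCubic_P8` (`Motives/HirschowitzIyerQuadricCubic`) follows from:
  for all `Q, C` as there with `V₊(Q)` integral and `V₊(Q) ⊄ V₊(C)`, the Gysin map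
  `CH₂(V₊(Q)) → CH₁(V₊(Q, C))` is surjective after `⊗ ℚ` — which is the content of HI's
  surjectivity theorem at `r = 1` together with the covering of `V₊(Q, C)` by strong lines (§§3–6),
  plus the two elementary consequences of the Jacobian condition recorded as hypotheses.

Everything here is proved; no named facts are introduced.

## References

* A. Hirschowitz, J. N. Iyer, *Hilbert schemes of fat r-planes and the triviality of Chow groups
  of complete intersections*, Contemp. Math. 522 (2010), §§1.4, 1.6, 2. [HirschowitzIyer2010]
* W. Fulton, *Intersection Theory*, 2nd ed. (1998), Def. 2.4.1, §2.6. [Fulton1998]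
-/

noncomputable section

universe u

open CategoryTheory AlgebraicGeometry Order Topology TopologicalSpace
open Literature.AlgebraicGeometry.Motives.Segre Literature.AlgebraicGeometry.Motives.RatFn

attribute [local instance] MvPolynomial.gradedAlgebra

namespace Literature.AlgebraicGeometry.Motives

/-! ### `ℚ`-rank `≤ 1` passes along `ℚ`-surjections -/

/-- If `f : A → B` is surjective after tensoring with `ℚ` (`∀ b, ∃ N ≠ 0, N • b ∈ f(A)`) and any two
elements of `A` satisfy a non-trivial integral relation, then so do any two elements of `B`.
[folklore] -/
theorem rankLEOne_of_forall_exists_zsmul_eq {A B : Type*} [AddCommGroup A] [AddCommGroup B]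
    (f : A →+ B) (hf : ∀ b : B, ∃ N : ℤ, N ≠ 0 ∧ ∃ a : A, N • b = f a)
    (hA : ∀ a a' : A, ∃ m n : ℤ, (m ≠ 0 ∨ n ≠ 0) ∧ m • a = n • a') (b b' : B) :
    ∃ m n : ℤ, (m ≠ 0 ∨ n ≠ 0) ∧ m • b = n • b' := by
  obtain ⟨N, hN, a, ha⟩ := hf b
  obtain ⟨N', hN', a', ha'⟩ := hf b'
  obtain ⟨m, n, hmn, hrel⟩ := hA a a'
  refine ⟨m * N, n * N', ?_, ?_⟩
  · rcases hmn with h | h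
    · exact Or.inl (mul_ne_zero h hN)
    · exact Or.inr (mul_ne_zero h hN')
  · rw [mul_smul, mul_smul, ha, ha', ← map_zsmul, ← map_zsmul, hrel]

/-! ### The Gysin map of the pair `V₊(Q, C) ⊂ V₊(Q)` -/

section QuadricCubic

variable {n : ℕ} {K : Type u} [Field K] (Q C : MvPolynomial (Fin (n + 1)) K)

/-- Abbreviation: `Y' = V₊(Q)` as a `K`-scheme. [folklore] -/
abbrev quadric : SchemeOver K := completeIntersection (fun _ : Fin 1 => Q)

/-- Abbreviation: `Y = V₊(Q, C)` as a `K`-scheme. [folklore] -/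
abbrev quadricCubic : SchemeOver K := completeIntersection ![Q, C]

/-- `V₊(Q) → Spec K` is locally of finite type (`ℙⁿ → Spec K` is proper, `ProjSpace.isProper_over`).
[folklore] -/
instance locallyOfFiniteType_quadric_hom : LocallyOfFiniteType (quadric Q).hom := by
  haveI : IsProper (projectiveSpace n K).hom := inferInstanceAs (IsProper ((ProjSpace.P n K) ↘ Spec (.of K)))
  haveI : LocallyOfFiniteType (completeIntersectionι (fun _ : Fin 1 => Q)).left := inferInstance
  change LocallyOfFiniteType ((completeIntersectionι (fun _ : Fin 1 => Q)).left ≫ (projectiveSpace n K).hom)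
  infer_instance

/-- `V₊(Q)` is quasi-compact. [folklore] -/
instance compactSpace_quadric_left : CompactSpace ↥(quadric Q).left :=
  haveI : CompactSpace ↥(projectiveSpace n K).left := inferInstanceAs (CompactSpace (ProjSpace.P n K))
  (completeIntersectionι (fun _ : Fin 1 => Q)).left.isClosedEmbedding.compactSpace

/-- `V₊(Q)` is locally Noetherian. [folklore] -/
instance isLocallyNoetherian_quadric_left : IsLocallyNoetherian (quadric Q).left :=
  haveI : IsProper (projectiveSpace n K).hom := inferInstanceAs (IsProper ((ProjSpace.P n K) ↘ Spec (.of K)))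
  haveI : IsLocallyNoetherian (projectiveSpace n K).left :=
    LocallyOfFiniteType.isLocallyNoetherian (projectiveSpace n K).hom
  LocallyOfFiniteType.isLocallyNoetherian (completeIntersectionι (fun _ : Fin 1 => Q)).left

/-- The embedding `V₊(Q) ↪ ℙⁿ` on underlying schemes, into the spelling `ProjSpace.P n K` of `ℙⁿ`
used by `Motives/ProjectiveSpaceFormDivisors` (it is `(completeIntersectionι _).left`). [folklore] -/
def quadricι : (quadric Q).left ⟶ ProjSpace.P n K := (completeIntersectionι (fun _ : Fin 1 => Q)).left

/-- (`rfl`) [folklore] -/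
theorem quadricι_eq : quadricι Q = (completeIntersectionι (fun _ : Fin 1 => Q)).left := rfl

/-- `V₊(Q) ↪ ℙⁿ` is a closed immersion. [folklore] -/
instance isClosedImmersion_quadricι : IsClosedImmersion (quadricι Q) :=
  inferInstanceAs (IsClosedImmersion (completeIntersectionι (fun _ : Fin 1 => Q)).left)

variable {Q C} [IsIntegral (quadric Q).left] {e : ℕ} (he : 0 < e)
  (hC : C ∈ grading (Fin (n + 1)) K e) (hC0 : C ≠ 0)
  (hCη : C ∉ (quadricι Q (genericPoint (quadric Q).left)).asHomogeneousIdeal)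

/-- **The section `D = V₊(C)|_{V₊(Q)}`** of the (integral) quadric by the form `C` not vanishing on
it: an effective Cartier divisor on `V₊(Q)`. [folklore] -/
def cubicSection : CartierDivisor (quadric Q).left :=
  (ProjSpace.formDivisor C hC hC0).pullbackAvoiding (quadricι Q)
    ((ProjSpace.formDivisor_avoids_iff hC hC0 he).mpr hCη)

/-- `D = V₊(C)|_{V₊(Q)}` is effective. [folklore] -/
theorem isEffective_cubicSection : (cubicSection he hC hC0 hCη).IsEffective :=
  (ProjSpace.isEffective_formDivisor hC hC0).pullbackAvoiding _ _

/-- **`|D| = V₊(Q, C)`**: the image of `V₊(Q, C) ↪ V₊(Q)` is the support of `V₊(C)|_{V₊(Q)}`.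
[folklore] -/
theorem range_quadricCubicToQuadric_eq :
    Set.range (quadricCubicToQuadric Q C).left.base = {x | ¬ (cubicSection he hC hC0 hCη).Avoids x} := by
  rw [quadricCubicToQuadric, range_completeIntersectionInclusion_left]
  ext x
  rw [Set.mem_preimage, Set.mem_setOf_eq, cubicSection,
    ProjSpace.avoids_pullbackAvoiding_formDivisor_iff _ he hC hC0, not_not]
  change Set.range ![Q, C] ⊆ _ ↔ C ∈ (quadricι Q x).asHomogeneousIdeal
  rw [Set.range_subset_iff, Fin.forall_fin_two]
  simp only [Matrix.cons_val_zero, Matrix.cons_val_one, SetLike.mem_coe]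
  refine ⟨fun h => h.2, fun h => ⟨?_, h⟩⟩
  -- `Q` vanishes on `V₊(Q)`
  have hx : quadricι Q x ∈
      ProjectiveSpectrum.zeroLocus (grading (Fin (n + 1)) K) (Set.range (fun _ : Fin 1 => Q)) := by
    rw [quadricι_eq, ← range_completeIntersectionι]
    exact ⟨x, rfl⟩
  exact hx ⟨0, rfl⟩

/-- **The restriction (Gysin) homomorphism `CH_{d+1}(V₊(Q)) → CH_d(V₊(Q, C))`, `α ↦ V₊(C) · α`,**
of Hirschowitz–Iyer §2 (Fulton's intersection with the effective Cartier divisor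
`V₊(C)|_{V₊(Q)}`, Def. 2.4.1), for `V₊(Q)` integral and `V₊(Q) ⊄ V₊(C)`.
[cite: HirschowitzIyer2010, §2 (the restriction map QCH_{r+1}(Y') → QCH_r(Y))] -/
def quadricCubicGysin (d : ℕ) : ChowGroup (quadric Q).left (d + 1) →+ ChowGroup (quadricCubic Q C).left d :=
  (isEffective_cubicSection he hC hC0 hCη).gysin (quadricCubicToQuadric Q C).left
    (range_quadricCubicToQuadric_eq he hC hC0 hCη)
    (ProjSpace.gysin_hypotheses (quadricι Q) he hC hC0 ((ProjSpace.formDivisor_avoids_iff hC hC0 he).mpr hCη)).1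
    (ProjSpace.gysin_hypotheses (quadricι Q) he hC hC0 ((ProjSpace.formDivisor_avoids_iff hC hC0 he).mpr hCη)).2 d

end QuadricCubic

/-! ### The hypotheses from the Jacobian condition -/

section Jacobian

variable {n : ℕ} {K : Type u} [Field K] {Q C : MvPolynomial (Fin (n + 2)) K}

/-- **`V₊(Q)` is integral** when `(Q, C)` satisfies the Jacobian condition (`Q` a quadric, `C` of
degree `d ≥ 1`, at least four variables): `Q` is prime (`IsNonsingularSystem.prime_fst`,
`Motives/JacobianQuadricCubic`). [folklore] -/
theorem isIntegral_quadric_left_of_isNonsingularSystem (hn : 2 ≤ n) (hQ : Q.IsHomogeneous 2)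
    {d : ℕ} (hd : 1 ≤ d) (hC : C.IsHomogeneous d) (hJ : IsNonsingularSystem K ![Q, C]) :
    IsIntegral (quadric Q).left :=
  isIntegral_completeIntersection_of_prime Q hQ (hJ.prime_fst hn hQ hd hC)

/-- `C ≠ 0` when `(Q, C)` satisfies the Jacobian condition (`Q ∤ C`). [folklore] -/
theorem ne_zero_snd_of_isNonsingularSystem (hQ : Q.IsHomogeneous 2) (hJ : IsNonsingularSystem K ![Q, C]) :
    C ≠ 0 := fun h =>
  hJ.not_dvd_snd (by norm_num) hQ (h ▸ dvd_zero Q)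

/-- **`V₊(Q) ⊄ V₊(C)`** when `(Q, C)` satisfies the Jacobian condition: `C` is not in the homogeneous
prime of the generic point of `V₊(Q)` (which is `(Q)`, and `Q ∤ C`). [folklore] -/
theorem notMem_quadricι_genericPoint_of_isNonsingularSystem (hn : 2 ≤ n) (hQ : Q.IsHomogeneous 2)
    {d : ℕ} (hd : 1 ≤ d) (hC : C.IsHomogeneous d) (hJ : IsNonsingularSystem K ![Q, C]) :
    haveI := isIntegral_quadric_left_of_isNonsingularSystem hn hQ hd hC hJ
    C ∉ (quadricι Q (genericPoint (quadric Q).left)).asHomogeneousIdeal := by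
  haveI := isIntegral_quadric_left_of_isNonsingularSystem hn hQ hd hC hJ
  exact (mem_asHomogeneousIdeal_genericPoint_iff_dvd Q hQ (hJ.prime_fst hn hQ hd hC) C).not.mpr
    (hJ.not_dvd_snd (by norm_num) hQ)

end Jacobian

/-! ### Reduction of the named fact to the `ℚ`-surjectivity of the Gysin map -/

/-- **Hirschowitz–Iyer's theorem for `(Q, C)` on `ℙ⁸` follows from the `ℚ`-surjectivity of the
Gysin map `CH₂(V₊(Q)) → CH₁(V₊(Q, C))`** (HI, Main Theorem §1.6 from the surjectivity theorem
§1.4/§2: "`QCH₂(Y') → QCH₁(Y)` is onto", whose hypothesis — `Y = V₊(Q, C)` covered by strong lines —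
holds by §§3–6 since `ρ + r = 6 ≥ n - s = 6`). The integrality of `V₊(Q)` and `V₊(Q) ⊄ V₊(C)` come
from the Jacobian condition (`Motives/JacobianQuadricCubic`). What remains open in the tree is
exactly the hypothesis `hsurj`. [cite: HirschowitzIyer2010, §1.6 (Main Theorem, from §1.4 and §6)] -/
theorem HirschowitzIyer2010_QCH1_quadricCubic_P8_of_gysin_surjective
    (hsurj : ∀ (Q C : MvPolynomial (Fin (7 + 2)) ℂ) (hQ : Q.IsHomogeneous 2) (hC : C.IsHomogeneous 3)
      (hJ : IsNonsingularSystem ℂ ![Q, C]),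
      haveI := isIntegral_quadric_left_of_isNonsingularSystem (by norm_num) hQ (by norm_num) hC hJ
      ∀ b : ChowGroup (quadricCubic Q C).left 1, ∃ N : ℤ, N ≠ 0 ∧
        ∃ a : ChowGroup (quadric Q).left (1 + 1),
          N • b = quadricCubicGysin (by norm_num : 0 < 3) hC (ne_zero_snd_of_isNonsingularSystem hQ hJ)
            (notMem_quadricι_genericPoint_of_isNonsingularSystem (by norm_num) hQ (by norm_num) hC hJ) 1 a) :
    HirschowitzIyer2010_QCH1_quadricCubic_P8 := by
  intro Q C hQ hC hJ hrank a b
  haveI := isIntegral_quadric_left_of_isNonsingularSystem (n := 7) (by norm_num) hQ (by norm_num) hC hJ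
  exact rankLEOne_of_forall_exists_zsmul_eq (quadricCubicGysin (by norm_num : 0 < 3) hC
    (ne_zero_snd_of_isNonsingularSystem hQ hJ)
    (notMem_quadricι_genericPoint_of_isNonsingularSystem (by norm_num) hQ (by norm_num) hC hJ) 1)
    (hsurj Q C hQ hC hJ) hrank a b

end Literature.AlgebraicGeometry.Motives

end
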